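import Mathlib

/-!
# SoloInformedInvariantQuotient — the algebraic core of THEOREM Z (Z4)

Solo seat `solo-Langlands-informed`, session s34 (gen 37), paper `EtaleDirection.md` §7.11 (16.13)(o).

THEOREM Z (Z3)–(Z4) there runs: the norm class `b(η)` of `ζ₇` lives in a quotient
`Ā = A/(7A + j C_S)` of the `ℤ₇[Γ]`-module `A = Cl_S(L) ⊗ ℤ₇`, it is fixed by the prime-to-`7`
group `Δ_η` *modulo* the submodule, and `A^{Δ_η} = Cl_S(F_η) ⊗ ℤ₇ = 0` when `7 ∤ h_S(F_η)`;
hence `b(η) = 0`. The only algebra used is the lemma below: for a representation `ρ` of a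
finite group `G` on a module `V` over a ring in which `|G|` is invertible, a vector fixed by
every `ρ g` modulo a submodule `W` (not assumed `ρ`-stable) is congruent modulo `W` to a
`ρ`-invariant vector (its average); so if `ρ` has no non-zero invariants the vector lies in `W`.
Self-contained (own averaging operator); Mathlib only.
-/

namespace Summit.Langlands.Langlands.Theorems

open BigOperators

variable {k V G : Type*} [CommRing k] [AddCommGroup V] [Module k V] [Group G] [Fintype G]

/-- The averaging operator `v ↦ ⅟|G| • ∑ g, ρ g v` of a representation. -/
noncomputable def soloInformedAvg (ρ : Representation k G V) [Invertible (Fintype.card G : k)] :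
    V →ₗ[k] V :=
  ⅟(Fintype.card G : k) • ∑ g : G, ρ g

/-- Pointwise formula for the averaging operator. -/
theorem soloInformedAvg_apply (ρ : Representation k G V) [Invertible (Fintype.card G : k)]
    (v : V) : soloInformedAvg ρ v = ⅟(Fintype.card G : k) • ∑ g : G, ρ g v := by
  simp [soloInformedAvg, LinearMap.sum_apply]

/-- The average of any vector is `ρ`-invariant. -/
theorem soloInformedAvg_mem_invariants (ρ : Representation k G V)
    [Invertible (Fintype.card G : k)] (v : V) : soloInformedAvg ρ v ∈ ρ.invariants := by
  rw [Representation.mem_invariants]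
  intro h
  rw [soloInformedAvg_apply, map_smul, map_sum]
  congr 1
  have key : ∀ g : G, ρ h (ρ g v) = ρ (h * g) v := by
    intro g
    rw [map_mul, Module.End.mul_apply]
  simp_rw [key]
  exact Fintype.sum_bijective (fun g => h * g) (Group.mulLeft_bijective h)
    (fun g => ρ (h * g) v) (fun g => ρ g v) (fun _ => rfl)

/-- A vector fixed by every `ρ g` modulo `W` is congruent to its average modulo `W`
(`W` need not be `ρ`-stable). -/
theorem soloInformedAvg_sub_mem (ρ : Representation k G V) [Invertible (Fintype.card G : k)]
    (W : Submodule k V) (v : V) (hv : ∀ g : G, ρ g v - v ∈ W) :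
    soloInformedAvg ρ v - v ∈ W := by
  have h1 : soloInformedAvg ρ v - v = ⅟(Fintype.card G : k) • ∑ g : G, (ρ g v - v) := by
    rw [Finset.sum_sub_distrib, Finset.sum_const, Finset.card_univ, ← Nat.cast_smul_eq_nsmul k,
      smul_sub, smul_smul, invOf_mul_self', one_smul, soloInformedAvg_apply]
  rw [h1]
  exact W.smul_mem _ (W.sum_mem fun g _ => hv g)

/-- THEOREM Z (Z4), algebraic core, first form: fixed modulo `W` ⟹ congruent modulo `W` to an
invariant vector. -/
theorem soloInformed_exists_invariant_sub_mem (ρ : Representation k G V)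
    [Invertible (Fintype.card G : k)] (W : Submodule k V) (v : V)
    (hv : ∀ g : G, ρ g v - v ∈ W) : ∃ u ∈ ρ.invariants, u - v ∈ W :=
  ⟨soloInformedAvg ρ v, soloInformedAvg_mem_invariants ρ v, soloInformedAvg_sub_mem ρ W v hv⟩

/-- THEOREM Z (Z4), algebraic core, second form: if `ρ` has no non-zero invariants, a vector
fixed by every `ρ g` modulo `W` lies in `W` ("the quotient has no invariants either"). -/
theorem soloInformed_mem_of_invariants_eq_bot (ρ : Representation k G V)
    [Invertible (Fintype.card G : k)] (hρ : ρ.invariants = ⊥) (W : Submodule k V) (v : V)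
    (hv : ∀ g : G, ρ g v - v ∈ W) : v ∈ W := by
  obtain ⟨u, hu, huv⟩ := soloInformed_exists_invariant_sub_mem ρ W v hv
  rw [hρ, Submodule.mem_bot] at hu
  rw [hu, zero_sub] at huv
  exact (Submodule.neg_mem_iff W).mp huv

end Summit.Langlands.Langlands.Theorems
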